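import Summits.SmoothPoincare4.SmoothPoincare4.Theses.ZeroSurgeryExotic
import Literature.Topology.FourManifolds.Rasmussen
import Literature.Topology.FourManifolds.ZeroSurgeryHomotopyBallSliceHolds
import Literature.Topology.FourManifolds.SliceDiscInTransport
import Literature.Topology.FourManifolds.GluckTwist
import Literature.Barriers.SmoothPoincare4.GluckTwistsDissolve
import Literature.Barriers.SmoothPoincare4.GluckTwistsDissolveRasmussenProofs
import Literature.Uncategorized.Crux
import Literature.Topology.FourManifolds.HomotopyBallSliceProofs

/-!
# Line `mirror-double-meridian-class` for crux `ZeroSurgeryExotic.ZseSVanishesOnPairs` (stmt-SmoothPoincare4-0368)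

Crux (ledger signature verbatim; = the tree's registered open statement
`Literature.Uncategorized.SVanishesOnPairs`): on a `0`-surgery pair `(K, K', Y)` with `K` smoothly slice, every
Rasmussen invariant of `K'` vanishes.

## The line (idea card `Cruxes/ZseSVanishesOnPairs/Ideas/mirror-double-meridian-class.md`, triage r1-1/2/3: pass ×3)

Let `D = g(𝔻²)` be a slice disc of `K`, `V° = B̊⁴ ∖ D` its open exterior (`sliceDiscExterior g`), and let
`(X, e, f, j)` be the Manolescu–Piccirillo PAIR SPHERE of the pair: the closed smooth `X = X₀(K') ∪_φ (B⁴ ∖ νD)`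
with its ball `e`, the proper disc `f` for `K'` (core of the dual 2-handle) and the open embedding
`j : V° ↪ X` onto `X ∖ (e(𝔻⁴) ∪ f(𝔻²))` — exactly the datum produced by the tree's PROVED
`Knot.ManolescuPiccirillo2023_lemma33_sphere_construction_holds`.  The exterior `V°` is simultaneously the
exterior of `D ⊂ B⁴` and of `Δ' = f(𝔻²) ⊂ X° := X ∖ e(B̊⁴)`; the meridian of `Δ'` is the dual curve
`γ = φ(μ_{K'})` of `K'`, the meridian of `D` is the dual curve `μ_D` of `K`.

* MIRROR DOUBLE, one dimension up: `X # X̄ = D(X°) = ∂(X° × I)` and `X° × I = (V × I) ∪ H⁵_γ`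
  (`V × I = B⁵ ∖ ν(D × I)`, one 5-dimensional 2-handle along `γ`).  A 5-dimensional 2-handle sees its attaching
  circle only up to FREE HOMOTOPY in the 4-manifold `∂(V × I) = D(V)` (circles in 4-manifolds: homotopy ⇒
  isotopy) plus a `ℤ/2` framing.  Hence, IF `γ ≃ μ_D^{±1}` freely in `V°` — condition (B1),
  `IsHomotopicallyMeridional` below — then `X° × I ≅ (V × I) ∪ H⁵_{μ_D, fr}`, whose boundary is `S⁴` (product
  framing; `B⁴ × I`) or the Gluck twist of `S⁴` along the doubled disc `S_D = D ∪ D̄` (twisted framing).  Both are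
  Gluck twists of `S⁴` (`S⁴ = Gluck(unknot)`, tree fact `isGluckTwist_sphere_unknotTwo_holds`), `K'` is slice in
  `X`, hence in `X # X̄` (tree, PROVED: `Knot.IsSliceDiscIn.exists_of_isConnectedSum`), hence `s(K') = 0` by
  MMSW 2023 Cor. 1.13 (tree named fact `rasmussen_eq_zero_of_isSliceDiscIn_gluckTwist`).
* (B1) is a statement about ONE free homotopy class in `π₁(V°) = π₁(B⁴ ∖ D) =: G_D` (a conjugacy problem,
  decidable-in-practice on examples), ACHIRAL, insensitive to the 3-dimensional knotting of `γ` in `Y`; for a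
  `ℤ`-disc (`G_D` abelian, hence `= H₁ = ℤ`) it is AUTOMATIC (stub 2, unconditional).

## Stubs (registered; `sorry` only inside them) and composition

1. `stub_meridionalSupply`  — THE BET (hardest): every `0`-surgery pair with `K` slice admits a slice disc `g`
   and a pair-sphere datum with `G_D` abelian OR (B1).  (`∃φ ∃D`: the datum ranges over all `0`-surgery
   homeomorphisms and all slice discs.)
2. `stub_zDiscMeridional`   — unconditional special case: `G_D` abelian ⇒ (B1) (normal generation of `G_D` by
   `γ` from `π₁(X) = 1`, and by `μ_D` from `π₁(B⁴) = 1`; `G_D` abelian ⇒ `G_D = H₁(B⁴ ∖ D) = ℤ` ⇒ `γ = μ_D^{±1}`).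
3. `stub_doubleEngine`      — the 5-dimensional certificate: datum ∧ (B1) ⇒ some connected sum `P` of `X` with
   `X` (namely `X # X̄ = ∂(X° × I)`) is a closed smooth Gluck twist of `S⁴`.
4. `stub_gluckSliceVanishing` — MMSW 2023 Cor. 1.13, verbatim the tree's named fact.

`crux_of_stubs : MeridionalSupply → ZDiscMeridional → DoubleEngine → GluckSliceVanishing → Crux` (sorry-free glue) and
`ZseSVanishesOnPairs_of : ZseSVanishesOnPairs := crux_of_stubs stub_meridionalSupply … stub_gluckSliceVanishing`
(the only theorem of this file concluding the crux BY ITS ROUTE NAME; it becomes the crux proof when the four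
stubs are sorry-free).  (Obligation-tag attributes are gate-reserved in crux work files, hence the stub
propositions are plain untagged `def`s.)

## Honesty box (triage corrections carried; see the line card `Lines/mirror-double-meridian-class.md`)

* SLICENESS COLLAPSE (TRIAGE r1-1 correction, r1-2 caveat 1, certified in the triager's `Triage.lean`): whenever
  the double `P` is diffeomorphic to `S⁴` — the product-framing branch, and the Gluck branch for every RIBBON `g`
  (`S_D` is then a ribbon 2-knot, whose Gluck twist is standard) — the certificate proves `K'` SMOOTHLY SLICE
  (`isSmoothlySlice_of_double_sphere` below, from the landed Negative lemma
  `Negative.isSmoothlySlice_of_isSliceDiscIn_of_diffeomorph_sphere`), i.e. it is a certificate for the route's kill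
  switch `Assembly2`, and then yields the crux only through Rasmussen's theorem.  Genuinely `s`-specific content
  lives only in the branch "`g` non-ribbon, `Gluck(D ∪ D̄)` possibly exotic".
* SAME BET AS THE OLD LINE `two-knot-meridional-dual`, weaker certificate: stubs 1–3 compose to the LEVER of
  `Theorems/ZseSVanishesOnPairs/Negative/Targets.lean` (`gluckLever_of_stubs`), so by the landed
  `Negative.exoticGluckTwist_of_gluckLever` the stubs together with the route's thesis `ZseThesis` produce an
  EXOTIC GLUCK TWIST (`exoticGluckTwist_of_stubs`), and together with "Gluck twists are standard" they give
  `Assembly2` (`assembly2_of_stubs_of_gluckStandard`).  The certificate (B1) is strictly weaker than the old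
  line's "meridional dual up to ISOTOPY in `Y`" (homotopy in `V°`, one dimension up) — that is the delta.
* Disproof.lean (cdisprove gen 1) honoured: `crux_false_without_slice` — the slice disc `g` is the protagonist of
  stubs 1–3; `crux_false_without_commonSurgery/_surgeryLeft/_surgeryRight` — a pair-sphere datum exists iff
  `S³₀(K) ≅ S³₀(K')` (no datum for `K = U`, `K' = T(2,3)`); `crux_false_without_invariant` — `HasRasmussenInvariant`
  enters through stub 4 only; §4 strengthenings — `g` is a SMOOTH `IsSliceDisc` (`cruxTop_false_…`), `s(K)` is
  never used (`cruxSZero/SInvariant_false_…`), framing `0` is built into the datum (`cruxFraming_false_…`); §1 —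
  stub 4 alone re-proves Rasmussen's theorem (`rasmussen_of_stub4`), as every proof of the crux must; §5/Targets —
  see the previous bullet.  No stub is an instance of a landed Negative lemma's refuted statement (the four
  landed files `Theorems/ZseSVanishesOnPairs/Negative/{LoadBearing,Position,Strengthenings,Targets}.lean` are
  imported BY NAME in the scratch rendering of this file, `gen_line.py --with-negatives`, checked separately so
  that this work file depends on no `Theorems/` module; the two Targets lemmas it uses are re-derived in §5).

## Infrastructure note (SHIM)

The route file `Theses/ZeroSurgeryExotic.lean` does NOT yet declare `ZseSVanishesOnPairs` (it is a TODO comment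
there: the decl needs `import Literature.Topology.FourManifolds.Rasmussen` for `Knot.HasRasmussenInvariant`; the
refuters' notes on the item ask the route planner for that `route edit`).  So that the skeleton audit can see a
theorem concluding the crux BY ITS ROUTE NAME, this file declares the decl itself, verbatim from the ledger
signature, in a fenced SHIM block; it is definitionally the tree's `Literature.Uncategorized.SVanishesOnPairs`
(`crux_iff_sVanishesOnPairs`).  DELETE THE SHIM BLOCK when the route decl materialises (nothing else changes).
-/

noncomputable section

set_option linter.dupNamespace false
set_option linter.unusedVariables false

open scoped Manifold ContDiff Topology
open Set Function

/-! ## SHIM — the route decl, verbatim from the ledger signature of stmt-SmoothPoincare4-0368 (delete when materialised) -/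

namespace Summit.SmoothPoincare4.SmoothPoincare4.Theses.ZeroSurgeryExotic

/-- SHIM for the unmaterialised route item stmt-SmoothPoincare4-0368 (`ZeroSurgeryExotic.ZseSVanishesOnPairs`,
crux, rank 4), ledger signature verbatim.  Definitionally equal to `Literature.Uncategorized.SVanishesOnPairs`.
Delete this block once `ledger route edit` writes the decl into `Theses/ZeroSurgeryExotic.lean`.
[cite: ManolescuMarengonSarkarWillis2023, Question 9.11] -/
def ZseSVanishesOnPairs : Prop :=
  ∀ (K K' : Literature.Topology.FourManifolds.Knot) (Y : Type) [TopologicalSpace Y] [ChartedSpace (EuclideanSpace ℝ (Fin 3)) Y] (s : ℤ), Literature.Topology.FourManifolds.IsIntegralSurgery (𝓡 3) Y K 0 → Literature.Topology.FourManifolds.IsIntegralSurgery (𝓡 3) Y K' 0 → K.IsSmoothlySlice → K'.HasRasmussenInvariant s → s = 0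

end Summit.SmoothPoincare4.SmoothPoincare4.Theses.ZeroSurgeryExotic

/-! ## The line -/

namespace Summit.SmoothPoincare4.SmoothPoincare4.Cruxes.ZseSVanishesOnPairs.MirrorDoubleMeridianClass

open Literature.Topology.FourManifolds
open Summit.SmoothPoincare4.SmoothPoincare4.Theses.ZeroSurgeryExotic

/-- Local notation: the model space `ℝⁿ`. -/
local notation "𝔼 " n:arg => EuclideanSpace ℝ (Fin n)
/-- Local notation: the unit sphere `𝕊ⁿ ⊂ ℝⁿ⁺¹`. -/
local notation "𝕊 " n:arg => (Metric.sphere (0 : EuclideanSpace ℝ (Fin (n + 1))) 1)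
/-- Local notation: the closed unit disc in `ℝ²`. -/
local notation "𝔻²" => Metric.closedBall (0 : EuclideanSpace ℝ (Fin 2)) 1

/-! ### §0 The crux by name -/

/-- The crux, by its route name (the SHIM above until the route file declares it). [folklore] -/
abbrev Crux : Prop := ZseSVanishesOnPairs

/-- The route decl is, verbatim, the tree's registered open statement (so `Disproof.lean` and the landed
`Theorems/ZseSVanishesOnPairs/Negative/*` lemmas, all stated over `SVanishesOnPairs`, apply to it). [folklore] -/
theorem crux_iff_sVanishesOnPairs : Crux ↔ Literature.Uncategorized.SVanishesOnPairs := Iff.rfl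

/-! ### §1 The two notions of the line (local abbreviations; the registered stubs spell them out) -/

/-- **(B1) — the dual curve of `K'` is homotopically meridional.**  For a disc `g : ℝ² → ℝ⁴` (a slice disc
`D = g(𝔻²)` of `K`) and a pair-sphere datum `(X, e, f, j)` (`f(𝔻²)` the proper disc bounded by `K'` off the ball
`e(𝔻⁴)`, `j : B̊⁴ ∖ D ↪ X` onto the complement of `e(𝔻⁴) ∪ f(𝔻²)`): there are
* a MERIDIAN DISC `δ` of `f(𝔻²)`: a smooth map `ℝ² → X` whose closed unit disc misses `e(𝔻⁴)`, meets `f(𝔻²)`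
  only at its centre `δ 0 = f q` (`‖q‖ < 1`), transversally (read in the extended chart of `X` at `f q`, the two
  differentials span `ℝ⁴`) — so that
  `∂δ` is, up to orientation, the meridian of `f(𝔻²)` in `X ∖ (e(𝔻⁴) ∪ f(𝔻²))`, i.e. the dual curve `γ` of `K'`;
* a MERIDIAN DISC `δ₀` of `g(𝔻²)` inside the open unit ball (same conditions) — `∂δ₀` is `μ_D^{±1}`;
* a FREE HOMOTOPY `H` from `∂δ` to `j ∘ ∂δ₀` through loops in `range j = X ∖ (e(𝔻⁴) ∪ f(𝔻²)) ≅ B̊⁴ ∖ D`.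
The sign `±1` is absorbed by the orientation of `δ₀`.  Equivalently: `[γ]` is conjugate to `[μ_D]^{±1}` in
`G_D = π₁(B⁴ ∖ D)`. [cite: GabaiNaylorSchwartz2025, §3] -/
def IsHomotopicallyMeridional (g : 𝔼 2 → 𝔼 4) (X : Type*) [TopologicalSpace X] [ChartedSpace (𝔼 4) X]
    (e : 𝔼 4 → X) (f : 𝔼 2 → X) (j : sliceDiscExterior g → X) : Prop :=
  ∃ (δ : EuclideanSpace ℝ (Fin 2) → X) (δ₀ : EuclideanSpace ℝ (Fin 2) → EuclideanSpace ℝ (Fin 4))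
    (H : unitInterval × (Metric.sphere (0 : EuclideanSpace ℝ (Fin 2)) 1) → X),
    ContMDiff (𝓡 2) (𝓡 4) ∞ δ ∧
    (∀ x ∈ Metric.closedBall (0 : EuclideanSpace ℝ (Fin 2)) 1, δ x ∉ e '' Metric.closedBall (0 : EuclideanSpace ℝ (Fin 4)) 1) ∧
    (∀ x ∈ Metric.closedBall (0 : EuclideanSpace ℝ (Fin 2)) 1, x ≠ 0 → δ x ∉ f '' Metric.closedBall (0 : EuclideanSpace ℝ (Fin 2)) 1) ∧
    (∃ q : EuclideanSpace ℝ (Fin 2), ‖q‖ < 1 ∧ δ 0 = f q ∧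
      ∀ v : EuclideanSpace ℝ (Fin 4), ∃ a b : EuclideanSpace ℝ (Fin 2),
        v = fderiv ℝ (extChartAt (𝓡 4) (f q) ∘ δ) 0 a + fderiv ℝ (extChartAt (𝓡 4) (f q) ∘ f) q b) ∧
    ContDiff ℝ ∞ δ₀ ∧
    (∀ x ∈ Metric.closedBall (0 : EuclideanSpace ℝ (Fin 2)) 1, ‖δ₀ x‖ < 1) ∧
    (∀ x ∈ Metric.closedBall (0 : EuclideanSpace ℝ (Fin 2)) 1, x ≠ 0 → δ₀ x ∉ g '' Metric.closedBall (0 : EuclideanSpace ℝ (Fin 2)) 1) ∧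
    (∃ q₀ : EuclideanSpace ℝ (Fin 2), ‖q₀‖ < 1 ∧ δ₀ 0 = g q₀ ∧
      ∀ v : EuclideanSpace ℝ (Fin 4), ∃ a b : EuclideanSpace ℝ (Fin 2), v = fderiv ℝ δ₀ 0 a + fderiv ℝ g q₀ b) ∧
    Continuous H ∧
    (∀ θ : (Metric.sphere (0 : EuclideanSpace ℝ (Fin 2)) 1), H (0, θ) = δ θ) ∧
    (∀ θ : (Metric.sphere (0 : EuclideanSpace ℝ (Fin 2)) 1), ∃ h : (δ₀ θ : EuclideanSpace ℝ (Fin 4)) ∈ sliceDiscExterior g,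
      H (1, θ) = j ⟨δ₀ θ, h⟩) ∧
    (∀ p, H p ∈ Set.range j)

/-- **`ℤ`-disc condition**: the fundamental group of the open slice-disc exterior `B̊⁴ ∖ g(𝔻²)` is abelian (hence,
by Alexander duality `H₁(B⁴ ∖ D) = ℤ`, infinite cyclic generated by the meridian). [folklore] -/
def HasAbelianExteriorGroup (g : 𝔼 2 → 𝔼 4) : Prop :=
  ∀ (x : sliceDiscExterior g) (a b : FundamentalGroup (sliceDiscExterior g) x), a * b = b * a

/-! ### §2 The stubs as named propositions (readable form; the hypotheses of `crux_of_stubs`) -/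

/-- **Stub 1 — MERIDIONAL SUPPLY (the bet; hardest).**  For every `0`-surgery pair `(K, K', Y)` with `K` smoothly
slice there are a slice disc `g` of `K` and a simply connected pair-sphere datum `(X, e, f, j)` for `K'` over
`B̊⁴ ∖ g(𝔻²)` such that EITHER the exterior group is abelian (`ℤ`-disc) OR the dual curve of `K'` is homotopically
meridional (B1).  Data exist for every pair (MP Lemma 3.3 construction, proved in the tree) and range over every
`0`-surgery homeomorphism `φ : S³₀(K) → S³₀(K')` and every slice disc; the content is the disjunction.
Why it might fail: a weight element of a knot-like group need not be conjugate to the meridian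
(Silver–Whitten–Williams-type examples); for RIBBON `g` it even forces `K'` slice (honesty box).  Cheapest
falsifier: GAP conjugacy separation in finite quotients of a ribbon group of `J₀` for Manolescu–Piccirillo's
annulus-twist pairs `J_n` (§6 of arXiv:2102.04391). [cite: ManolescuPiccirillo2023, §6] -/
def MeridionalSupply : Prop :=
  ∀ (K K' : Knot) (Y : Type) [TopologicalSpace Y] [ChartedSpace (EuclideanSpace ℝ (Fin 3)) Y],
    IsIntegralSurgery (𝓡 3) Y K 0 → IsIntegralSurgery (𝓡 3) Y K' 0 → K.IsSmoothlySlice →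
    ∃ (g : EuclideanSpace ℝ (Fin 2) → EuclideanSpace ℝ (Fin 4)) (X : Type) (_ : TopologicalSpace X) (_ : T2Space X)
      (_ : SecondCountableTopology X) (_ : ChartedSpace (EuclideanSpace ℝ (Fin 4)) X) (_ : IsManifold (𝓡 4) ∞ X)
      (_ : CompactSpace X) (_ : SimplyConnectedSpace X)
      (e : EuclideanSpace ℝ (Fin 4) → X) (f : EuclideanSpace ℝ (Fin 2) → X) (j : sliceDiscExterior g → X),
      K.IsSliceDisc g ∧ K'.IsSliceDiscIn X e f ∧ Manifold.IsSmoothEmbedding (𝓡 4) (𝓡 4) ∞ j ∧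
      Set.range j = (e '' Metric.closedBall (0 : EuclideanSpace ℝ (Fin 4)) 1 ∪ f '' Metric.closedBall (0 : EuclideanSpace ℝ (Fin 2)) 1)ᶜ ∧
      ((∀ (x : sliceDiscExterior g) (a b : FundamentalGroup (sliceDiscExterior g) x), a * b = b * a) ∨
       (∃ (δ : EuclideanSpace ℝ (Fin 2) → X) (δ₀ : EuclideanSpace ℝ (Fin 2) → EuclideanSpace ℝ (Fin 4))
          (H : unitInterval × (Metric.sphere (0 : EuclideanSpace ℝ (Fin 2)) 1) → X),
          ContMDiff (𝓡 2) (𝓡 4) ∞ δ ∧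
          (∀ x ∈ Metric.closedBall (0 : EuclideanSpace ℝ (Fin 2)) 1, δ x ∉ e '' Metric.closedBall (0 : EuclideanSpace ℝ (Fin 4)) 1) ∧
          (∀ x ∈ Metric.closedBall (0 : EuclideanSpace ℝ (Fin 2)) 1, x ≠ 0 → δ x ∉ f '' Metric.closedBall (0 : EuclideanSpace ℝ (Fin 2)) 1) ∧
          (∃ q : EuclideanSpace ℝ (Fin 2), ‖q‖ < 1 ∧ δ 0 = f q ∧
            ∀ v : EuclideanSpace ℝ (Fin 4), ∃ a b : EuclideanSpace ℝ (Fin 2),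
              v = fderiv ℝ (extChartAt (𝓡 4) (f q) ∘ δ) 0 a + fderiv ℝ (extChartAt (𝓡 4) (f q) ∘ f) q b) ∧
          ContDiff ℝ ∞ δ₀ ∧
          (∀ x ∈ Metric.closedBall (0 : EuclideanSpace ℝ (Fin 2)) 1, ‖δ₀ x‖ < 1) ∧
          (∀ x ∈ Metric.closedBall (0 : EuclideanSpace ℝ (Fin 2)) 1, x ≠ 0 → δ₀ x ∉ g '' Metric.closedBall (0 : EuclideanSpace ℝ (Fin 2)) 1) ∧
          (∃ q₀ : EuclideanSpace ℝ (Fin 2), ‖q₀‖ < 1 ∧ δ₀ 0 = g q₀ ∧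
            ∀ v : EuclideanSpace ℝ (Fin 4), ∃ a b : EuclideanSpace ℝ (Fin 2), v = fderiv ℝ δ₀ 0 a + fderiv ℝ g q₀ b) ∧
          Continuous H ∧
          (∀ θ : (Metric.sphere (0 : EuclideanSpace ℝ (Fin 2)) 1), H (0, θ) = δ θ) ∧
          (∀ θ : (Metric.sphere (0 : EuclideanSpace ℝ (Fin 2)) 1), ∃ h : (δ₀ θ : EuclideanSpace ℝ (Fin 4)) ∈ sliceDiscExterior g,
            H (1, θ) = j ⟨δ₀ θ, h⟩) ∧
          (∀ p, H p ∈ Set.range j)))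

/-- **Stub 2 — the `ℤ`-disc case is unconditional.**  For a simply connected pair-sphere datum over a slice disc
whose exterior group `G` is abelian, (B1) holds: `G = G/1` is normally generated by the meridian `γ` of `f(𝔻²)`
(`π₁(X°) = π₁(X) = 1` and `X° = V ∪_γ h²`) and by `μ_D` (`B⁴ = V ∪_{μ_D} h²`), and `G` abelian forces
`G = H₁(B⁴ ∖ D) = ℤ` (Alexander duality; tree: `H_*(B̊⁴ ∖ Δ) ≅ H_*(S¹)` in
`ZeroSurgeryHomotopyBallSliceHomology.lean`), so `γ = μ_D^{±1}`; meridian discs exist for injective immersions,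
and equal free homotopy classes give the homotopy `H`.  TRIAGE r1-3's "first thing to land". [folklore] -/
def ZDiscMeridional : Prop :=
  ∀ (K K' : Knot) (g : EuclideanSpace ℝ (Fin 2) → EuclideanSpace ℝ (Fin 4)) (X : Type) [TopologicalSpace X] [T2Space X]
    [SecondCountableTopology X] [ChartedSpace (EuclideanSpace ℝ (Fin 4)) X] [IsManifold (𝓡 4) ∞ X]
    [CompactSpace X] [SimplyConnectedSpace X]
    (e : EuclideanSpace ℝ (Fin 4) → X) (f : EuclideanSpace ℝ (Fin 2) → X) (j : sliceDiscExterior g → X),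
    K.IsSliceDisc g → K'.IsSliceDiscIn X e f → Manifold.IsSmoothEmbedding (𝓡 4) (𝓡 4) ∞ j →
    Set.range j = (e '' Metric.closedBall (0 : EuclideanSpace ℝ (Fin 4)) 1 ∪ f '' Metric.closedBall (0 : EuclideanSpace ℝ (Fin 2)) 1)ᶜ →
    (∀ (x : sliceDiscExterior g) (a b : FundamentalGroup (sliceDiscExterior g) x), a * b = b * a) →
    ∃ (δ : EuclideanSpace ℝ (Fin 2) → X) (δ₀ : EuclideanSpace ℝ (Fin 2) → EuclideanSpace ℝ (Fin 4))
      (H : unitInterval × (Metric.sphere (0 : EuclideanSpace ℝ (Fin 2)) 1) → X),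
      ContMDiff (𝓡 2) (𝓡 4) ∞ δ ∧
      (∀ x ∈ Metric.closedBall (0 : EuclideanSpace ℝ (Fin 2)) 1, δ x ∉ e '' Metric.closedBall (0 : EuclideanSpace ℝ (Fin 4)) 1) ∧
      (∀ x ∈ Metric.closedBall (0 : EuclideanSpace ℝ (Fin 2)) 1, x ≠ 0 → δ x ∉ f '' Metric.closedBall (0 : EuclideanSpace ℝ (Fin 2)) 1) ∧
      (∃ q : EuclideanSpace ℝ (Fin 2), ‖q‖ < 1 ∧ δ 0 = f q ∧
        ∀ v : EuclideanSpace ℝ (Fin 4), ∃ a b : EuclideanSpace ℝ (Fin 2),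
          v = fderiv ℝ (extChartAt (𝓡 4) (f q) ∘ δ) 0 a + fderiv ℝ (extChartAt (𝓡 4) (f q) ∘ f) q b) ∧
      ContDiff ℝ ∞ δ₀ ∧
      (∀ x ∈ Metric.closedBall (0 : EuclideanSpace ℝ (Fin 2)) 1, ‖δ₀ x‖ < 1) ∧
      (∀ x ∈ Metric.closedBall (0 : EuclideanSpace ℝ (Fin 2)) 1, x ≠ 0 → δ₀ x ∉ g '' Metric.closedBall (0 : EuclideanSpace ℝ (Fin 2)) 1) ∧
      (∃ q₀ : EuclideanSpace ℝ (Fin 2), ‖q₀‖ < 1 ∧ δ₀ 0 = g q₀ ∧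
        ∀ v : EuclideanSpace ℝ (Fin 4), ∃ a b : EuclideanSpace ℝ (Fin 2), v = fderiv ℝ δ₀ 0 a + fderiv ℝ g q₀ b) ∧
      Continuous H ∧
      (∀ θ : (Metric.sphere (0 : EuclideanSpace ℝ (Fin 2)) 1), H (0, θ) = δ θ) ∧
      (∀ θ : (Metric.sphere (0 : EuclideanSpace ℝ (Fin 2)) 1), ∃ h : (δ₀ θ : EuclideanSpace ℝ (Fin 4)) ∈ sliceDiscExterior g,
        H (1, θ) = j ⟨δ₀ θ, h⟩) ∧
      (∀ p, H p ∈ Set.range j)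

/-- **Stub 3 — the DOUBLE ENGINE (5-dimensional certificate).**  For a simply connected pair-sphere datum with
(B1), some connected sum `P` of `X` with `X` (namely the mirror double `X # X̄ = D(X°) = ∂(X° × I)`; the tree's
`IsConnectedSum` is orientation-free, so `X # X̄` qualifies) is a closed smooth Gluck twist of `S⁴`:
`X° × I = (V × I) ∪ H⁵_γ`; by (B1) and homotopy-implies-isotopy for circles in the 4-manifold `∂(V × I)`,
`X° × I ≅ (V × I) ∪ H⁵_{μ_D, fr}` with `fr ∈ π₁(SO(3)) = ℤ/2`; its boundary is `S⁴ = ∂(B⁴ × I)` (product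
framing; `S⁴` is the Gluck twist on the unknot, `isGluckTwist_sphere_unknotTwo_holds`) or the Gluck twist of
`S⁴ = ∂B⁵` along `S_D = ∂(D × I) = D ∪ D̄` (twisted framing: surgery on `S⁴` along `S_D` followed by the
twisted surgery on its meridian regives `(S⁴ ∖ νS_D) ∪_τ S² × D²`).  Sources: Smale / Kervaire–Milnor
(`Σ° × I ≅ B⁵ ⟺ Σ # Σ̄ ≅ S⁴`), Gabai–Naylor–Schwartz arXiv:2307.06388 §3 (5-dimensional 2-handles: homotopy
class + `ℤ/2`), Gluck 1962 §§8, 17, Gompf–Stipsicz Ex. 5.2.7.  Why it might fail: only through a slip in the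
framing bookkeeping (both framings are covered) — it is a theorem in print up to assembly; Lean size XL.
[cite: GabaiNaylorSchwartz2025, §3] -/
def DoubleEngine : Prop :=
  ∀ (K K' : Knot) (g : EuclideanSpace ℝ (Fin 2) → EuclideanSpace ℝ (Fin 4)) (X : Type) [TopologicalSpace X] [T2Space X]
    [SecondCountableTopology X] [ChartedSpace (EuclideanSpace ℝ (Fin 4)) X] [IsManifold (𝓡 4) ∞ X]
    [CompactSpace X] [SimplyConnectedSpace X]
    (e : EuclideanSpace ℝ (Fin 4) → X) (f : EuclideanSpace ℝ (Fin 2) → X) (j : sliceDiscExterior g → X),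
    K.IsSliceDisc g → K'.IsSliceDiscIn X e f → Manifold.IsSmoothEmbedding (𝓡 4) (𝓡 4) ∞ j →
    Set.range j = (e '' Metric.closedBall (0 : EuclideanSpace ℝ (Fin 4)) 1 ∪ f '' Metric.closedBall (0 : EuclideanSpace ℝ (Fin 2)) 1)ᶜ →
    (∃ (δ : EuclideanSpace ℝ (Fin 2) → X) (δ₀ : EuclideanSpace ℝ (Fin 2) → EuclideanSpace ℝ (Fin 4))
        (H : unitInterval × (Metric.sphere (0 : EuclideanSpace ℝ (Fin 2)) 1) → X),
        ContMDiff (𝓡 2) (𝓡 4) ∞ δ ∧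
        (∀ x ∈ Metric.closedBall (0 : EuclideanSpace ℝ (Fin 2)) 1, δ x ∉ e '' Metric.closedBall (0 : EuclideanSpace ℝ (Fin 4)) 1) ∧
        (∀ x ∈ Metric.closedBall (0 : EuclideanSpace ℝ (Fin 2)) 1, x ≠ 0 → δ x ∉ f '' Metric.closedBall (0 : EuclideanSpace ℝ (Fin 2)) 1) ∧
        (∃ q : EuclideanSpace ℝ (Fin 2), ‖q‖ < 1 ∧ δ 0 = f q ∧
          ∀ v : EuclideanSpace ℝ (Fin 4), ∃ a b : EuclideanSpace ℝ (Fin 2),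
            v = fderiv ℝ (extChartAt (𝓡 4) (f q) ∘ δ) 0 a + fderiv ℝ (extChartAt (𝓡 4) (f q) ∘ f) q b) ∧
        ContDiff ℝ ∞ δ₀ ∧
        (∀ x ∈ Metric.closedBall (0 : EuclideanSpace ℝ (Fin 2)) 1, ‖δ₀ x‖ < 1) ∧
        (∀ x ∈ Metric.closedBall (0 : EuclideanSpace ℝ (Fin 2)) 1, x ≠ 0 → δ₀ x ∉ g '' Metric.closedBall (0 : EuclideanSpace ℝ (Fin 2)) 1) ∧
        (∃ q₀ : EuclideanSpace ℝ (Fin 2), ‖q₀‖ < 1 ∧ δ₀ 0 = g q₀ ∧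
          ∀ v : EuclideanSpace ℝ (Fin 4), ∃ a b : EuclideanSpace ℝ (Fin 2), v = fderiv ℝ δ₀ 0 a + fderiv ℝ g q₀ b) ∧
        Continuous H ∧
        (∀ θ : (Metric.sphere (0 : EuclideanSpace ℝ (Fin 2)) 1), H (0, θ) = δ θ) ∧
        (∀ θ : (Metric.sphere (0 : EuclideanSpace ℝ (Fin 2)) 1), ∃ h : (δ₀ θ : EuclideanSpace ℝ (Fin 4)) ∈ sliceDiscExterior g,
          H (1, θ) = j ⟨δ₀ θ, h⟩) ∧
        (∀ p, H p ∈ Set.range j)) →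
    ∃ (P : Type) (_ : TopologicalSpace P) (_ : T2Space P) (_ : SecondCountableTopology P)
      (_ : ChartedSpace (EuclideanSpace ℝ (Fin 4)) P) (_ : IsManifold (𝓡 4) ∞ P) (_ : CompactSpace P),
      IsConnectedSum (𝓡 4) (𝓡 4) (𝓡 4) X X P ∧ ∃ K₂ : TwoKnot, IsGluckTwist (𝓡 4) P K₂

/-- **Stub 4 — MMSW 2023 Cor. 1.13 (knot case)**, verbatim the tree's named fact
`Literature.Barriers.SmoothPoincare4.rasmussen_eq_zero_of_isSliceDiscIn_gluckTwist` (`gluckSliceVanishing_iff`):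
a knot bounding a smooth proper disc off a ball in a smooth Gluck twist of `S⁴` has `s = 0`.
[cite: ManolescuMarengonSarkarWillis2023, Cor. 1.13] -/
def GluckSliceVanishing : Prop :=
  ∀ (K₂ : TwoKnot) (X : Type) [TopologicalSpace X] [T2Space X] [SecondCountableTopology X]
    [ChartedSpace (EuclideanSpace ℝ (Fin 4)) X] [IsManifold (𝓡 4) ∞ X] (_hX : IsGluckTwist (𝓡 4) X K₂)
    (K : Knot) (e : EuclideanSpace ℝ (Fin 4) → X) (f : EuclideanSpace ℝ (Fin 2) → X) (_hK : K.IsSliceDiscIn X e f)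
    (s : ℤ) (_hs : K.HasRasmussenInvariant s), s = 0

/-- Stub 4 is literally the tree's named fact. [cite: ManolescuMarengonSarkarWillis2023, Cor. 1.13] -/
theorem gluckSliceVanishing_iff :
    GluckSliceVanishing ↔ Literature.Barriers.SmoothPoincare4.rasmussen_eq_zero_of_isSliceDiscIn_gluckTwist :=
  Iff.rfl

/-! ### §3 The registered stubs (`sorry` lives ONLY here; signatures spelled out over tree vocabulary) -/

/-- Registered stub 1 = `MeridionalSupply` (spelled out). [cite: ManolescuPiccirillo2023, §6] -/
theorem stub_meridionalSupply :
    ∀ (K K' : Knot) (Y : Type) [TopologicalSpace Y] [ChartedSpace (EuclideanSpace ℝ (Fin 3)) Y],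
      IsIntegralSurgery (𝓡 3) Y K 0 → IsIntegralSurgery (𝓡 3) Y K' 0 → K.IsSmoothlySlice →
      ∃ (g : EuclideanSpace ℝ (Fin 2) → EuclideanSpace ℝ (Fin 4)) (X : Type) (_ : TopologicalSpace X) (_ : T2Space X)
        (_ : SecondCountableTopology X) (_ : ChartedSpace (EuclideanSpace ℝ (Fin 4)) X) (_ : IsManifold (𝓡 4) ∞ X)
        (_ : CompactSpace X) (_ : SimplyConnectedSpace X)
        (e : EuclideanSpace ℝ (Fin 4) → X) (f : EuclideanSpace ℝ (Fin 2) → X) (j : sliceDiscExterior g → X),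
        K.IsSliceDisc g ∧ K'.IsSliceDiscIn X e f ∧ Manifold.IsSmoothEmbedding (𝓡 4) (𝓡 4) ∞ j ∧
        Set.range j = (e '' Metric.closedBall (0 : EuclideanSpace ℝ (Fin 4)) 1 ∪ f '' Metric.closedBall (0 : EuclideanSpace ℝ (Fin 2)) 1)ᶜ ∧
        ((∀ (x : sliceDiscExterior g) (a b : FundamentalGroup (sliceDiscExterior g) x), a * b = b * a) ∨
         (∃ (δ : EuclideanSpace ℝ (Fin 2) → X) (δ₀ : EuclideanSpace ℝ (Fin 2) → EuclideanSpace ℝ (Fin 4))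
            (H : unitInterval × (Metric.sphere (0 : EuclideanSpace ℝ (Fin 2)) 1) → X),
            ContMDiff (𝓡 2) (𝓡 4) ∞ δ ∧
            (∀ x ∈ Metric.closedBall (0 : EuclideanSpace ℝ (Fin 2)) 1, δ x ∉ e '' Metric.closedBall (0 : EuclideanSpace ℝ (Fin 4)) 1) ∧
            (∀ x ∈ Metric.closedBall (0 : EuclideanSpace ℝ (Fin 2)) 1, x ≠ 0 → δ x ∉ f '' Metric.closedBall (0 : EuclideanSpace ℝ (Fin 2)) 1) ∧
            (∃ q : EuclideanSpace ℝ (Fin 2), ‖q‖ < 1 ∧ δ 0 = f q ∧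
              ∀ v : EuclideanSpace ℝ (Fin 4), ∃ a b : EuclideanSpace ℝ (Fin 2),
                v = fderiv ℝ (extChartAt (𝓡 4) (f q) ∘ δ) 0 a + fderiv ℝ (extChartAt (𝓡 4) (f q) ∘ f) q b) ∧
            ContDiff ℝ ∞ δ₀ ∧
            (∀ x ∈ Metric.closedBall (0 : EuclideanSpace ℝ (Fin 2)) 1, ‖δ₀ x‖ < 1) ∧
            (∀ x ∈ Metric.closedBall (0 : EuclideanSpace ℝ (Fin 2)) 1, x ≠ 0 → δ₀ x ∉ g '' Metric.closedBall (0 : EuclideanSpace ℝ (Fin 2)) 1) ∧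
            (∃ q₀ : EuclideanSpace ℝ (Fin 2), ‖q₀‖ < 1 ∧ δ₀ 0 = g q₀ ∧
              ∀ v : EuclideanSpace ℝ (Fin 4), ∃ a b : EuclideanSpace ℝ (Fin 2), v = fderiv ℝ δ₀ 0 a + fderiv ℝ g q₀ b) ∧
            Continuous H ∧
            (∀ θ : (Metric.sphere (0 : EuclideanSpace ℝ (Fin 2)) 1), H (0, θ) = δ θ) ∧
            (∀ θ : (Metric.sphere (0 : EuclideanSpace ℝ (Fin 2)) 1), ∃ h : (δ₀ θ : EuclideanSpace ℝ (Fin 4)) ∈ sliceDiscExterior g,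
              H (1, θ) = j ⟨δ₀ θ, h⟩) ∧
            (∀ p, H p ∈ Set.range j))) := by
  sorry

/-- Registered stub 2 = `ZDiscMeridional` (spelled out). [folklore] -/
theorem stub_zDiscMeridional :
    ∀ (K K' : Knot) (g : EuclideanSpace ℝ (Fin 2) → EuclideanSpace ℝ (Fin 4)) (X : Type) [TopologicalSpace X] [T2Space X]
      [SecondCountableTopology X] [ChartedSpace (EuclideanSpace ℝ (Fin 4)) X] [IsManifold (𝓡 4) ∞ X]
      [CompactSpace X] [SimplyConnectedSpace X]
      (e : EuclideanSpace ℝ (Fin 4) → X) (f : EuclideanSpace ℝ (Fin 2) → X) (j : sliceDiscExterior g → X),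
      K.IsSliceDisc g → K'.IsSliceDiscIn X e f → Manifold.IsSmoothEmbedding (𝓡 4) (𝓡 4) ∞ j →
      Set.range j = (e '' Metric.closedBall (0 : EuclideanSpace ℝ (Fin 4)) 1 ∪ f '' Metric.closedBall (0 : EuclideanSpace ℝ (Fin 2)) 1)ᶜ →
      (∀ (x : sliceDiscExterior g) (a b : FundamentalGroup (sliceDiscExterior g) x), a * b = b * a) →
      ∃ (δ : EuclideanSpace ℝ (Fin 2) → X) (δ₀ : EuclideanSpace ℝ (Fin 2) → EuclideanSpace ℝ (Fin 4))
        (H : unitInterval × (Metric.sphere (0 : EuclideanSpace ℝ (Fin 2)) 1) → X),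
        ContMDiff (𝓡 2) (𝓡 4) ∞ δ ∧
        (∀ x ∈ Metric.closedBall (0 : EuclideanSpace ℝ (Fin 2)) 1, δ x ∉ e '' Metric.closedBall (0 : EuclideanSpace ℝ (Fin 4)) 1) ∧
        (∀ x ∈ Metric.closedBall (0 : EuclideanSpace ℝ (Fin 2)) 1, x ≠ 0 → δ x ∉ f '' Metric.closedBall (0 : EuclideanSpace ℝ (Fin 2)) 1) ∧
        (∃ q : EuclideanSpace ℝ (Fin 2), ‖q‖ < 1 ∧ δ 0 = f q ∧
          ∀ v : EuclideanSpace ℝ (Fin 4), ∃ a b : EuclideanSpace ℝ (Fin 2),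
            v = fderiv ℝ (extChartAt (𝓡 4) (f q) ∘ δ) 0 a + fderiv ℝ (extChartAt (𝓡 4) (f q) ∘ f) q b) ∧
        ContDiff ℝ ∞ δ₀ ∧
        (∀ x ∈ Metric.closedBall (0 : EuclideanSpace ℝ (Fin 2)) 1, ‖δ₀ x‖ < 1) ∧
        (∀ x ∈ Metric.closedBall (0 : EuclideanSpace ℝ (Fin 2)) 1, x ≠ 0 → δ₀ x ∉ g '' Metric.closedBall (0 : EuclideanSpace ℝ (Fin 2)) 1) ∧
        (∃ q₀ : EuclideanSpace ℝ (Fin 2), ‖q₀‖ < 1 ∧ δ₀ 0 = g q₀ ∧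
          ∀ v : EuclideanSpace ℝ (Fin 4), ∃ a b : EuclideanSpace ℝ (Fin 2), v = fderiv ℝ δ₀ 0 a + fderiv ℝ g q₀ b) ∧
        Continuous H ∧
        (∀ θ : (Metric.sphere (0 : EuclideanSpace ℝ (Fin 2)) 1), H (0, θ) = δ θ) ∧
        (∀ θ : (Metric.sphere (0 : EuclideanSpace ℝ (Fin 2)) 1), ∃ h : (δ₀ θ : EuclideanSpace ℝ (Fin 4)) ∈ sliceDiscExterior g,
          H (1, θ) = j ⟨δ₀ θ, h⟩) ∧
        (∀ p, H p ∈ Set.range j) := by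
  sorry

/-- Registered stub 3 = `DoubleEngine` (spelled out). [cite: GabaiNaylorSchwartz2025, §3] -/
theorem stub_doubleEngine :
    ∀ (K K' : Knot) (g : EuclideanSpace ℝ (Fin 2) → EuclideanSpace ℝ (Fin 4)) (X : Type) [TopologicalSpace X] [T2Space X]
      [SecondCountableTopology X] [ChartedSpace (EuclideanSpace ℝ (Fin 4)) X] [IsManifold (𝓡 4) ∞ X]
      [CompactSpace X] [SimplyConnectedSpace X]
      (e : EuclideanSpace ℝ (Fin 4) → X) (f : EuclideanSpace ℝ (Fin 2) → X) (j : sliceDiscExterior g → X),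
      K.IsSliceDisc g → K'.IsSliceDiscIn X e f → Manifold.IsSmoothEmbedding (𝓡 4) (𝓡 4) ∞ j →
      Set.range j = (e '' Metric.closedBall (0 : EuclideanSpace ℝ (Fin 4)) 1 ∪ f '' Metric.closedBall (0 : EuclideanSpace ℝ (Fin 2)) 1)ᶜ →
      (∃ (δ : EuclideanSpace ℝ (Fin 2) → X) (δ₀ : EuclideanSpace ℝ (Fin 2) → EuclideanSpace ℝ (Fin 4))
          (H : unitInterval × (Metric.sphere (0 : EuclideanSpace ℝ (Fin 2)) 1) → X),
          ContMDiff (𝓡 2) (𝓡 4) ∞ δ ∧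
          (∀ x ∈ Metric.closedBall (0 : EuclideanSpace ℝ (Fin 2)) 1, δ x ∉ e '' Metric.closedBall (0 : EuclideanSpace ℝ (Fin 4)) 1) ∧
          (∀ x ∈ Metric.closedBall (0 : EuclideanSpace ℝ (Fin 2)) 1, x ≠ 0 → δ x ∉ f '' Metric.closedBall (0 : EuclideanSpace ℝ (Fin 2)) 1) ∧
          (∃ q : EuclideanSpace ℝ (Fin 2), ‖q‖ < 1 ∧ δ 0 = f q ∧
            ∀ v : EuclideanSpace ℝ (Fin 4), ∃ a b : EuclideanSpace ℝ (Fin 2),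
              v = fderiv ℝ (extChartAt (𝓡 4) (f q) ∘ δ) 0 a + fderiv ℝ (extChartAt (𝓡 4) (f q) ∘ f) q b) ∧
          ContDiff ℝ ∞ δ₀ ∧
          (∀ x ∈ Metric.closedBall (0 : EuclideanSpace ℝ (Fin 2)) 1, ‖δ₀ x‖ < 1) ∧
          (∀ x ∈ Metric.closedBall (0 : EuclideanSpace ℝ (Fin 2)) 1, x ≠ 0 → δ₀ x ∉ g '' Metric.closedBall (0 : EuclideanSpace ℝ (Fin 2)) 1) ∧
          (∃ q₀ : EuclideanSpace ℝ (Fin 2), ‖q₀‖ < 1 ∧ δ₀ 0 = g q₀ ∧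
            ∀ v : EuclideanSpace ℝ (Fin 4), ∃ a b : EuclideanSpace ℝ (Fin 2), v = fderiv ℝ δ₀ 0 a + fderiv ℝ g q₀ b) ∧
          Continuous H ∧
          (∀ θ : (Metric.sphere (0 : EuclideanSpace ℝ (Fin 2)) 1), H (0, θ) = δ θ) ∧
          (∀ θ : (Metric.sphere (0 : EuclideanSpace ℝ (Fin 2)) 1), ∃ h : (δ₀ θ : EuclideanSpace ℝ (Fin 4)) ∈ sliceDiscExterior g,
            H (1, θ) = j ⟨δ₀ θ, h⟩) ∧
          (∀ p, H p ∈ Set.range j)) →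
      ∃ (P : Type) (_ : TopologicalSpace P) (_ : T2Space P) (_ : SecondCountableTopology P)
        (_ : ChartedSpace (EuclideanSpace ℝ (Fin 4)) P) (_ : IsManifold (𝓡 4) ∞ P) (_ : CompactSpace P),
        IsConnectedSum (𝓡 4) (𝓡 4) (𝓡 4) X X P ∧ ∃ K₂ : TwoKnot, IsGluckTwist (𝓡 4) P K₂ := by
  sorry

/-- Registered stub 4 = `GluckSliceVanishing` (spelled out) = MMSW 2023 Cor. 1.13.
[cite: ManolescuMarengonSarkarWillis2023, Cor. 1.13] -/
theorem stub_gluckSliceVanishing :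
    ∀ (K₂ : TwoKnot) (X : Type) [TopologicalSpace X] [T2Space X] [SecondCountableTopology X]
      [ChartedSpace (EuclideanSpace ℝ (Fin 4)) X] [IsManifold (𝓡 4) ∞ X] (_hX : IsGluckTwist (𝓡 4) X K₂)
      (K : Knot) (e : EuclideanSpace ℝ (Fin 4) → X) (f : EuclideanSpace ℝ (Fin 2) → X) (_hK : K.IsSliceDiscIn X e f)
      (s : ℤ) (_hs : K.HasRasmussenInvariant s), s = 0 := by
  sorry

/-! ### §4 Composition: the stubs prove the crux BY NAME -/

/-- **The glue** (sorry-free).  Supply gives a slice disc and a pair-sphere datum for `K'`; in the `ℤ`-disc branch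
stub 2 upgrades to (B1); the engine makes a closed smooth Gluck twist `P` out of a connected sum of `X` with `X`;
`K'`, slice in `X`, stays slice in `P` (tree, proved: `Knot.IsSliceDiscIn.exists_of_isConnectedSum`); MMSW
Cor. 1.13 gives `s(K') = 0`.  Conclusion spelled `Crux` (the local abbrev) so that the skeleton audit sees exactly
one theorem concluding the route decl, `ZseSVanishesOnPairs_of`. [cite: ManolescuMarengonSarkarWillis2023, Cor. 1.13] -/
theorem crux_of_stubs :
    MeridionalSupply → ZDiscMeridional → DoubleEngine → GluckSliceVanishing → Crux := by
  intro hS hZ hE hM K K' Y _ _ s h1 h2 h3 h4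
  obtain ⟨g, X, _, _, _, _, _, _, _, e, f, j, hg, hf, hj, hr, hcase⟩ := hS K K' Y h1 h2 h3
  have hB : IsHomotopicallyMeridional g X e f j :=
    hcase.elim (fun hab => hZ K K' g X e f j hg hf hj hr hab) id
  obtain ⟨P, _, _, _, _, _, _, hP, K₂, hG⟩ := hE K K' g X e f j hg hf hj hr hB
  obtain ⟨e', f', hf'⟩ := hf.exists_of_isConnectedSum hP
  exact hM K₂ P hG K' e' f' hf' s h4

/-- **THE SKELETON THEOREM** — concludes the crux `ZeroSurgeryExotic.ZseSVanishesOnPairs` BY NAME from the four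
registered stubs (each spelled-out `stub_*` is definitionally its named proposition, which this application
certifies).  Not closed while the stubs are `sorry`; it IS the crux proof once they land. [folklore] -/
theorem ZseSVanishesOnPairs_of : ZseSVanishesOnPairs :=
  crux_of_stubs stub_meridionalSupply stub_zDiscMeridional stub_doubleEngine stub_gluckSliceVanishing

/-- The same, against the tree twin of the crux (what `Disproof.lean` and `Theorems/…/Negative/*` call the crux).
[folklore] -/
theorem sVanishesOnPairs_of_stubs : Literature.Uncategorized.SVanishesOnPairs :=
  crux_iff_sVanishesOnPairs.1 ZseSVanishesOnPairs_of

/-! ### §5 What the stubs amount to, against the landed Negative lemmas and Disproof.lean (sorry-free) -/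

/-- Stubs 1–3 compose to the LEVER of `Theorems/ZseSVanishesOnPairs/Negative/Targets.lean` ("on every `0`-surgery
pair with `K` slice, `K'` is slice in some smooth Gluck twist of `S⁴`") — the composite of the old line
`two-knot-meridional-dual`; this line differs in the CERTIFICATE (B1), not in the transfer target. [folklore] -/
theorem gluckLever_of_stubs (hS : MeridionalSupply) (hZ : ZDiscMeridional) (hE : DoubleEngine) :
    ∀ (K K' : Knot) (Y : Type) [TopologicalSpace Y] [ChartedSpace (EuclideanSpace ℝ (Fin 3)) Y],
      IsIntegralSurgery (𝓡 3) Y K 0 → IsIntegralSurgery (𝓡 3) Y K' 0 → K.IsSmoothlySlice →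
      ∃ (K₂ : TwoKnot) (X : Type) (_ : TopologicalSpace X) (_ : T2Space X)
        (_ : SecondCountableTopology X) (_ : ChartedSpace (EuclideanSpace ℝ (Fin 4)) X)
        (_ : IsManifold (𝓡 4) ∞ X), IsGluckTwist (𝓡 4) X K₂ ∧
          ∃ (e : EuclideanSpace ℝ (Fin 4) → X) (f : EuclideanSpace ℝ (Fin 2) → X), K'.IsSliceDiscIn X e f := by
  intro K K' Y _ _ h1 h2 h3
  obtain ⟨g, X, _, _, _, _, _, _, _, e, f, j, hg, hf, hj, hr, hcase⟩ := hS K K' Y h1 h2 h3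
  have hB : IsHomotopicallyMeridional g X e f j :=
    hcase.elim (fun hab => hZ K K' g X e f j hg hf hj hr hab) id
  obtain ⟨P, _, _, _, _, _, _, hP, K₂, hG⟩ := hE K K' g X e f j hg hf hj hr hB
  obtain ⟨e', f', hf'⟩ := hf.exists_of_isConnectedSum hP
  exact ⟨K₂, P, _, ‹_›, ‹_›, _, ‹_›, hG, e', f', hf'⟩

/-- **Palais, per manifold** (the landed Negative lemma
`Theorems.ZseSVanishesOnPairs.Negative.isSmoothlySlice_of_isSliceDiscIn_of_diffeomorph_sphere`, re-proved here verbatim so that this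
work file imports no `Theorems/` module): a knot bounding a smooth proper disc off a ball in a 4-manifold diffeomorphic to `S⁴` is
smoothly slice. [cite: Palais1960, Thm. B] -/
theorem isSmoothlySlice_of_isSliceDiscIn_of_diffeomorph_sphere {K : Knot} {M : Type} [TopologicalSpace M]
    [ChartedSpace (𝔼 4) M] [IsManifold (𝓡 4) ∞ M] {e : 𝔼 4 → M} {f : 𝔼 2 → M}
    (h : K.IsSliceDiscIn M e f) (φ : M ≃ₘ⟮𝓡 4, 𝓡 4⟯ 𝕊 4) : K.IsSmoothlySlice := by
  have h' := h.diffeomorph_comp φ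
  obtain ⟨U, c, hc₁, hc₂⟩ :=
    Knot.palais_ballComplement_sphere_four_holds (φ ∘ e) h'.isSmoothEmbedding
  obtain ⟨g, hg⟩ := h'.exists_isProperDisc c hc₁ hc₂
  exact Knot.isSmoothlySlice_of_isProperDisc_holds K g hg

/-- **WHAT THE LINE BETS ON** (= the landed Negative lemma `Negative.Targets.exoticGluckTwist_of_gluckLever` applied to
`gluckLever_of_stubs`; re-derived here): under stubs 1–3, any witness of the route's thesis (a `0`-surgery pair, `K` slice, `K'` NOT
slice) yields a Gluck twist of `S⁴` admitting no diffeomorphism to `S⁴`.  So on thesis pairs the double `X # X̄` of stub 3 must be an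
EXOTIC Gluck twist `Gluck(D ∪ D̄)` with `D` non-ribbon — the sliceness-collapse warning of TRIAGE r1-1 made formal.
[cite: ManolescuMarengonSarkarWillis2023, Question 9.12] -/
theorem exoticGluckTwist_of_stubs (hS : MeridionalSupply) (hZ : ZDiscMeridional) (hE : DoubleEngine)
    {K K' : Knot} {Y : Type} [TopologicalSpace Y] [ChartedSpace (𝔼 3) Y]
    (h1 : IsIntegralSurgery (𝓡 3) Y K 0) (h2 : IsIntegralSurgery (𝓡 3) Y K' 0)
    (h3 : K.IsSmoothlySlice) (h4 : ¬ K'.IsSmoothlySlice) :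
    ∃ (K₂ : TwoKnot) (X : Type) (_ : TopologicalSpace X) (_ : T2Space X)
      (_ : SecondCountableTopology X) (_ : ChartedSpace (𝔼 4) X)
      (_ : IsManifold (𝓡 4) ∞ X), IsGluckTwist (𝓡 4) X K₂ ∧
        IsEmpty (X ≃ₘ⟮𝓡 4, 𝓡 4⟯ 𝕊 4) ∧
        ∃ (e : 𝔼 4 → X) (f : 𝔼 2 → X), K'.IsSliceDiscIn X e f := by
  obtain ⟨K₂, X, _, _, _, _, _, hXG, e, f, hf⟩ := gluckLever_of_stubs hS hZ hE K K' Y h1 h2 h3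
  exact ⟨K₂, X, _, ‹_›, ‹_›, _, ‹_›, hXG,
    ⟨fun φ ↦ h4 (isSmoothlySlice_of_isSliceDiscIn_of_diffeomorph_sphere hf φ)⟩, e, f, hf⟩

/-- The same bet read positively (= the landed `Negative.Targets.zeroSurgeryDeterminesSliceness_of_gluckLever_of_gluckStandard`
on `gluckLever_of_stubs`): stubs 1–3 + "every Gluck twist of `S⁴` is standard" (Kirby Problem 4.24 affirmative) give the route's
KILL SWITCH `Assembly2` (`0`-surgery type determines sliceness), by name. [cite: GluckTAMS1962, §17] -/
theorem assembly2_of_stubs_of_gluckStandard (hS : MeridionalSupply) (hZ : ZDiscMeridional) (hE : DoubleEngine)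
    (hStd : ∀ (K₂ : TwoKnot) (X : Type) [TopologicalSpace X] [T2Space X] [SecondCountableTopology X]
      [ChartedSpace (𝔼 4) X] [IsManifold (𝓡 4) ∞ X], IsGluckTwist (𝓡 4) X K₂ →
      Nonempty (X ≃ₘ⟮𝓡 4, 𝓡 4⟯ 𝕊 4)) :
    -- body of the former route decl `Assembly2` (item stmt-SmoothPoincare4-0367), spelled out: the gate's LINT AUTOFIX of
    -- 2026-08-16T14:15:59Z dropped `Assembly2/3/4` from `Theses/ZeroSurgeryExotic.lean` (rev 8), which broke this
    -- orphan corollary at HEAD; repaired by lead c5 (2026-08-17) so that the line's skeleton elaborates again (no stub touched).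
    ∀ (K K' : Knot) (Y : Type) [TopologicalSpace Y] [ChartedSpace (𝔼 3) Y],
      IsIntegralSurgery (𝓡 3) Y K 0 → IsIntegralSurgery (𝓡 3) Y K' 0 → K.IsSmoothlySlice → K'.IsSmoothlySlice := by
  intro K K' Y _ _ h1 h2 h3
  obtain ⟨K₂, X, _, _, _, _, _, hXG, e, f, hf⟩ := gluckLever_of_stubs hS hZ hE K K' Y h1 h2 h3
  obtain ⟨φ⟩ := hStd K₂ X hXG
  exact isSmoothlySlice_of_isSliceDiscIn_of_diffeomorph_sphere hf φ

/-- **SLICENESS COLLAPSE** (TRIAGE r1-1 correction / r1-2 caveat 1, over the engine's own output): if the connected sum `P` produced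
for a datum is diffeomorphic to `S⁴` (product framing; or the Gluck branch with `g` ribbon), then `K'` is smoothly slice — no Rasmussen
invariant involved (tree: sliceness survives connected sums; Palais per manifold). [cite: Palais1960, Thm. B] -/
theorem isSmoothlySlice_of_double_sphere {K' : Knot} {X : Type} [TopologicalSpace X] [T2Space X]
    [ChartedSpace (𝔼 4) X] [IsManifold (𝓡 4) ∞ X] [ConnectedSpace X] {e : 𝔼 4 → X} {f : 𝔼 2 → X}
    (hf : K'.IsSliceDiscIn X e f) {P : Type} [TopologicalSpace P] [ChartedSpace (𝔼 4) P]
    [IsManifold (𝓡 4) ∞ P] (hP : IsConnectedSum (𝓡 4) (𝓡 4) (𝓡 4) X X P)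
    (φ : P ≃ₘ⟮𝓡 4, 𝓡 4⟯ 𝕊 4) : K'.IsSmoothlySlice := by
  obtain ⟨e', f', hf'⟩ := hf.exists_of_isConnectedSum hP
  exact isSmoothlySlice_of_isSliceDiscIn_of_diffeomorph_sphere hf' φ

/-- **Disproof §1 honoured**: stub 4 alone already implies Rasmussen's slice theorem (tree lemma of the barrier's proofs file), as
every proof of the crux must (`Disproof.rasmussen_of_crux`). [cite: Rasmussen2010, Thm. 1] -/
theorem rasmussen_of_stub4 (hM : GluckSliceVanishing) : eq_zero_of_isSmoothlySlice :=
  Literature.Barriers.SmoothPoincare4.rasmussen_eq_zero_of_isSliceDiscIn_gluckTwist.eq_zero_of_isSmoothlySlice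
    hM

/-- **Disproof §2 by name** (the tree's relating theorem): the crux follows from MMSW Question 9.11 — the line sits strictly inside
that implication (it proves Q9.11 only for pair spheres with homotopically meridional dual).
[cite: ManolescuMarengonSarkarWillis2023, Question 9.11] -/
theorem crux_of_question911 (hQ : Literature.Barriers.SmoothPoincare4.MMSW2023Question911Knot) : Crux :=
  crux_iff_sVanishesOnPairs.2 (Literature.Uncategorized.sVanishesOnPairs_of_mmsw2023Question911Knot hQ)


end Summit.SmoothPoincare4.SmoothPoincare4.Cruxes.ZseSVanishesOnPairs.MirrorDoubleMeridianClass

end
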